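import Mathlib
import HarnessLib
import Summits.ResolutionOfSingularities.ResolutionOfSingularities.Theorems.WildQuotientsWildQuotientResolutionS1aGraphRootDataGen

/-!
# S1a — R4c brick (ii), ring data at a FAR TANGENCY POINT: the cover `(x₀^{n₀}, N(x₁)^{n₁}, x₂^{n₂})` of an R4 root with INVARIANT third generator (`qhv_ringData'`)

[OURS · L1 W4.5c · lead-1 g17; plan-1 RULING R-F15v, SPEC `Lines/s1a_logminvertex-R4c-SPEC.md` §1 (1Q): at the far point `Q` of the cusp (and at every tangency point
of a depth-1 tail that is NOT a graph) the local tail `T(y, v)` is not in graph normal form, so the R4e tail-norm cover element `N(T)` fails `hrad`; it is replaced by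
a power of the EXACTLY INVARIANT generator `v = x₂`: cover `(x₀^{n₀}, N(x₁)^{n₁}, x₂^{n₂})` at `dbar = w₀n₀ = p·w₁n₁ = w₂n₂` for the ✓QhRoot datum (`σx₁ = x₁ + x₀`,
`σx₂ = x₂`, `w₀ = w₁ + sh`), with `hrad` by ✓`QhAbs.qha_hrad` (third element `≡ u₂′`), the `[x₀]`-chart killed by `u₀′^{n₀}/cⱼ`; pattern ✓`graphRoot_ringData'`] — NOT
statements of the manuscript; counted 0; AI-level work, weaker than expert review. Crux stmt-ResolutionOfSingularities-17941 `CyclicQuotientFourfolds`, line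
`s1a-logminvertex` v13 (`stub_reachLowerInFX`).
-/

set_option linter.dupNamespace false

noncomputable section

open Literature.AlgebraicGeometry.Resolution
open scoped LaurentPolynomial
open MvPolynomial
open Summit.ResolutionOfSingularities.ResolutionOfSingularities.Theorems.WildQuotientResolution.S1
open Summit.ResolutionOfSingularities.ResolutionOfSingularities.Theorems.WildQuotientResolution.S1.CoarseChart
open Summit.ResolutionOfSingularities.ResolutionOfSingularities.Theorems.WildQuotientResolution.S1.NodeAway
open Summit.ResolutionOfSingularities.ResolutionOfSingularities.Theorems.WildQuotientResolution.S1.CentreAway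
open Summit.ResolutionOfSingularities.ResolutionOfSingularities.Theorems.WildQuotientResolution.S1.BlowupCharts
open Summit.ResolutionOfSingularities.ResolutionOfSingularities.Theorems.WildQuotientResolution.S1.ReesBigrading
open Summit.ResolutionOfSingularities.ResolutionOfSingularities.Theorems.WildQuotientResolution.S1.GameFrame.GModel

namespace Summit.ResolutionOfSingularities.ResolutionOfSingularities.Theorems.WildQuotientResolution.S1.KillCert.QhAway

/-- **Cover element from a power of the THIRD generator**: `c = u₂′ⁿ` when `(y : L) = f₂ⁿ` and `dbar = w₂·n` (pattern ✓`qha_coverElement_zero_eq`). [folklore] -/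
theorem qha_coverElement_two_pow_eq {L : Type} [CommRing L] (f : Fin 3 → L) (w : Fin 3 → ℕ)
    {m : ℕ} (mo : Fin m → ℕ) (𝒜 : (Π j : Fin m, ZMod (mo j)) → AddSubgroup L) [GradedRing 𝒜] {dbar : ℕ} (y : ↥(𝒜 0)) (hy : y ∈ (traceFiltration 𝒜 f w).ideal dbar)
    (n : ℕ) (hdbar : dbar = w 2 * n) (hyval : (y : L) = f 2 ^ n) :
    coverElement 𝒜 f w dbar y hy = cobordantAlgebra.u' f w 2 ^ n := by
  symm
  refine Subtype.ext ?_
  rw [SubmonoidClass.coe_pow, cobordantAlgebra.coe_u', coe_coverElement, hyval, hdbar, mul_pow, ← map_pow, LaurentPolynomial.T_pow]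
  congr 2
  push_cast
  ring

variable {k : Type} [Field k] (σ : (MvPolynomial (Fin 4) k) ≃+* (MvPolynomial (Fin 4) k))
  (h0 : σ (X 0) = X 0) (h1 : σ (X 1) = X 1 + X 0) (h2 : σ (X 2) = X 2) (t₀ : (MvPolynomial (Fin 4) k)) (h3 : σ (X 3) = X 3 + t₀)
  (w : Fin 3 → ℕ) (sh : ℕ) (hw0 : w 0 = w 1 + sh)
  (hh : (MvPolynomial (Fin 4) k)) (hσh : σ hh = hh)
  {p : ℕ} (hp : 0 < p) (hσpL : ∀ y : (Localization.Away hh), (⇑(sigmaAway σ hσh))^[p] y = y)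
  (hσJ : ∀ n : ℕ, ((weightedFiltration (fun i => algebraMap (MvPolynomial (Fin 4) k) (Localization.Away hh) (X ((![0, 1, 2] : Fin 3 → Fin 4) i))) w).ideal n).map ((sigmaAway σ hσh) : (Localization.Away hh) →+* (Localization.Away hh)) ≤ (weightedFiltration (fun i => algebraMap (MvPolynomial (Fin 4) k) (Localization.Away hh) (X ((![0, 1, 2] : Fin 3 → Fin 4) i))) w).ideal n)
  {mg : ℕ} (mo : Fin mg → ℕ) (𝒜 : (Π j : Fin mg, ZMod (mo j)) → AddSubgroup (Localization.Away hh)) [GradedRing 𝒜] (h𝒜 : ∀ x : (Localization.Away hh), x ∈ 𝒜 0)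
  (hσp : ∀ a : (MvPolynomial (Fin 4) k), (⇑σ)^[p] a = a) (hh0 : hh ≠ 0)

set_option maxHeartbeats 4000000 in
include h0 h1 h2 h3 hw0 hσp hh0 h𝒜 in
/-- ★★ **RING DATA OF AN R4 ROOT WITH INVARIANT THIRD GENERATOR, cover `(x₀^{n₀}, N(x₁)^{n₁}, x₂^{n₂})`** at `dbar = w₀n₀ = p·w₁n₁ = w₂n₂`. See the module docstring.
[OURS · L1 W4.5c · R4c brick (ii); NOT a statement of the manuscript] -/
theorem qhv_ringData' [Fact p.Prime] [CharP k p] (dbar n₀ n₁ n₂ : ℕ) (hn₀ : 0 < n₀) (hn₁ : 0 < n₁)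
    (hd₀ : dbar = w 0 * n₀) (hd₁ : dbar = p * w 1 * n₁) (hd₂ : dbar = w 2 * n₂) :
    ∃ (y : Fin 3 → ↥(𝒜 0)) (hy : ∀ j, y j ∈ (traceFiltration 𝒜 (fun i => algebraMap (MvPolynomial (Fin 4) k) (Localization.Away hh) (X ((![0, 1, 2] : Fin 3 → Fin 4) i))) w).ideal dbar),
      (∀ j, (sigmaAway σ hσh) (y j : (Localization.Away hh)) = y j) ∧
      ((y 0 : (Localization.Away hh)) = (fun i => algebraMap (MvPolynomial (Fin 4) k) (Localization.Away hh) (X ((![0, 1, 2] : Fin 3 → Fin 4) i))) 0 ^ n₀) ∧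
      ((y 1 : (Localization.Away hh)) = (∏ i : ZMod p, ((fun i => algebraMap (MvPolynomial (Fin 4) k) (Localization.Away hh) (X ((![0, 1, 2] : Fin 3 → Fin 4) i))) 1 + (i.val : (Localization.Away hh)) * (fun i => algebraMap (MvPolynomial (Fin 4) k) (Localization.Away hh) (X ((![0, 1, 2] : Fin 3 → Fin 4) i))) 0)) ^ n₁) ∧
      ((y 2 : (Localization.Away hh)) = (fun i => algebraMap (MvPolynomial (Fin 4) k) (Localization.Away hh) (X ((![0, 1, 2] : Fin 3 → Fin 4) i))) 2 ^ n₂) ∧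
      coverElement 𝒜 (fun i => algebraMap (MvPolynomial (Fin 4) k) (Localization.Away hh) (X ((![0, 1, 2] : Fin 3 → Fin 4) i))) w dbar (y 0) (hy 0) = cobordantAlgebra.u' (fun i => algebraMap (MvPolynomial (Fin 4) k) (Localization.Away hh) (X ((![0, 1, 2] : Fin 3 → Fin 4) i))) w 0 ^ n₀ ∧
      coverElement 𝒜 (fun i => algebraMap (MvPolynomial (Fin 4) k) (Localization.Away hh) (X ((![0, 1, 2] : Fin 3 → Fin 4) i))) w dbar (y 1) (hy 1) = (∏ i : ZMod p, (cobordantAlgebra.u' (fun i => algebraMap (MvPolynomial (Fin 4) k) (Localization.Away hh) (X ((![0, 1, 2] : Fin 3 → Fin 4) i))) w 1 + algebraMap (Localization.Away hh) ↥(cobordantAlgebra (fun i => algebraMap (MvPolynomial (Fin 4) k) (Localization.Away hh) (X ((![0, 1, 2] : Fin 3 → Fin 4) i))) w) (i.val : (Localization.Away hh)) * (cobordantAlgebra.u' (fun i => algebraMap (MvPolynomial (Fin 4) k) (Localization.Away hh) (X ((![0, 1, 2] : Fin 3 → Fin 4) i))) w 0 * cobordantAlgebra.s (fun i => algebraMap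 (MvPolynomial (Fin 4) k) (Localization.Away hh) (X ((![0, 1, 2] : Fin 3 → Fin 4) i))) w ^ sh))) ^ n₁ ∧
      coverElement 𝒜 (fun i => algebraMap (MvPolynomial (Fin 4) k) (Localization.Away hh) (X ((![0, 1, 2] : Fin 3 → Fin 4) i))) w dbar (y 2) (hy 2) = cobordantAlgebra.u' (fun i => algebraMap (MvPolynomial (Fin 4) k) (Localization.Away hh) (X ((![0, 1, 2] : Fin 3 → Fin 4) i))) w 2 ^ n₂ ∧
      (∀ l : Fin 3, cobordantAlgebra.u' (fun i => algebraMap (MvPolynomial (Fin 4) k) (Localization.Away hh) (X ((![0, 1, 2] : Fin 3 → Fin 4) i))) w l ∈ (Ideal.span (Set.range fun j => coverElement 𝒜 (fun i => algebraMap (MvPolynomial (Fin 4) k) (Localization.Away hh) (X ((![0, 1, 2] : Fin 3 → Fin 4) i))) w dbar (y j) (hy j))).radical) ∧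
      (∀ j : Fin 3,
        algebraMap ↥(cobordantAlgebra (fun i => algebraMap (MvPolynomial (Fin 4) k) (Localization.Away hh) (X ((![0, 1, 2] : Fin 3 → Fin 4) i))) w) (ChartRing 𝒜 (fun i => algebraMap (MvPolynomial (Fin 4) k) (Localization.Away hh) (X ((![0, 1, 2] : Fin 3 → Fin 4) i))) w dbar (y j) (hy j)) (cobordantAlgebra.u' (fun i => algebraMap (MvPolynomial (Fin 4) k) (Localization.Away hh) (X ((![0, 1, 2] : Fin 3 → Fin 4) i))) w 0 ^ n₀) * IsLocalization.Away.invSelf (coverElement 𝒜 (fun i => algebraMap (MvPolynomial (Fin 4) k) (Localization.Away hh) (X ((![0, 1, 2] : Fin 3 → Fin 4) i))) w dbar (y j) (hy j)) ∈ chartNodeGrading mo 𝒜 (fun i => algebraMap (MvPolynomial (Fin 4) k) (Localization.Away hh) (X ((![0, 1, 2] : Fin 3 → Fin 4) i))) w (fun _ => h𝒜 _) dbar (y j) (hy j) 0 ∧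
        algebraMap ↥(cobordantAlgebra (fun i => algebraMap (MvPolynomial (Fin 4) k) (Localization.Away hh) (X ((![0, 1, 2] : Fin 3 → Fin 4) i))) w) (ChartRing 𝒜 (fun i => algebraMap (MvPolynomial (Fin 4) k) (Localization.Away hh) (X ((![0, 1, 2] : Fin 3 → Fin 4) i))) w dbar (y j) (hy j)) (cobordantAlgebra.u' (fun i => algebraMap (MvPolynomial (Fin 4) k) (Localization.Away hh) (X ((![0, 1, 2] : Fin 3 → Fin 4) i))) w 0 ^ n₀) * IsLocalization.Away.invSelf (coverElement 𝒜 (fun i => algebraMap (MvPolynomial (Fin 4) k) (Localization.Away hh) (X ((![0, 1, 2] : Fin 3 → Fin 4) i))) w dbar (y j) (hy j)) ∈ (((augmentationIdeal (sigmaR (sigmaAway σ hσh) (fun i => algebraMap (MvPolynomial (Fin 4) k) (Localization.Away hh) (X ((![0, 1, 2] : Fin 3 → Fin 4) i))) w hσJ hp hσpL)).colon (Ideal.span {cobordantAlgebra.s (fun i => algebraMap (MvPolynomial (Fin 4) k) (Localization.Away hh) (X ((![0, 1, 2] : Fin 3 → Fin 4) i))) w ^ sh}))).map (algebraMap ↥(cobordantAlgebra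 (fun i => algebraMap (MvPolynomial (Fin 4) k) (Localization.Away hh) (X ((![0, 1, 2] : Fin 3 → Fin 4) i))) w) (ChartRing 𝒜 (fun i => algebraMap (MvPolynomial (Fin 4) k) (Localization.Away hh) (X ((![0, 1, 2] : Fin 3 → Fin 4) i))) w dbar (y j) (hy j)))) := by
  classical
  haveI : NeZero p := ⟨(Fact.out : p.Prime).ne_zero⟩
  have hp1 : p ≠ 1 := (Fact.out : p.Prime).ne_one
  haveI : CharP (Localization.Away hh) p := qhl_charP hh hh0
  obtain ⟨r0, r1, r2, -⟩ := qhl_rows σ h0 h1 h2 t₀ h3 hh hσh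
  have hd₁' : dbar = p * w 1 * n₁ := hd₁
  -- the cover, kept opaque
  obtain ⟨cov, hcov⟩ : ∃ cov : Fin 3 → (Localization.Away hh), cov = ![(fun i => algebraMap (MvPolynomial (Fin 4) k) (Localization.Away hh) (X ((![0, 1, 2] : Fin 3 → Fin 4) i))) 0 ^ n₀, (∏ i : ZMod p, ((fun i => algebraMap (MvPolynomial (Fin 4) k) (Localization.Away hh) (X ((![0, 1, 2] : Fin 3 → Fin 4) i))) 1 + (i.val : (Localization.Away hh)) * (fun i => algebraMap (MvPolynomial (Fin 4) k) (Localization.Away hh) (X ((![0, 1, 2] : Fin 3 → Fin 4) i))) 0)) ^ n₁, (fun i => algebraMap (MvPolynomial (Fin 4) k) (Localization.Away hh) (X ((![0, 1, 2] : Fin 3 → Fin 4) i))) 2 ^ n₂] := ⟨_, rfl⟩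
  have hcov0 : cov 0 = (fun i => algebraMap (MvPolynomial (Fin 4) k) (Localization.Away hh) (X ((![0, 1, 2] : Fin 3 → Fin 4) i))) 0 ^ n₀ := by rw [hcov]; rfl
  have hcov1 : cov 1 = (∏ i : ZMod p, ((fun i => algebraMap (MvPolynomial (Fin 4) k) (Localization.Away hh) (X ((![0, 1, 2] : Fin 3 → Fin 4) i))) 1 + (i.val : (Localization.Away hh)) * (fun i => algebraMap (MvPolynomial (Fin 4) k) (Localization.Away hh) (X ((![0, 1, 2] : Fin 3 → Fin 4) i))) 0)) ^ n₁ := by rw [hcov]; rfl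
  have hcov2 : cov 2 = (fun i => algebraMap (MvPolynomial (Fin 4) k) (Localization.Away hh) (X ((![0, 1, 2] : Fin 3 → Fin 4) i))) 2 ^ n₂ := by rw [hcov]; rfl
  let y : Fin 3 → ↥(𝒜 0) := fun j => ⟨cov j, h𝒜 _⟩
  have hyval : ∀ j, (y j : (Localization.Away hh)) = cov j := fun _ => rfl
  have hy : ∀ j, y j ∈ (traceFiltration 𝒜 (fun i => algebraMap (MvPolynomial (Fin 4) k) (Localization.Away hh) (X ((![0, 1, 2] : Fin 3 → Fin 4) i))) w).ideal dbar := fun j => by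
    rw [mem_traceFiltration_iff, hyval]
    refine Fin.cases ?_ (Fin.cases ?_ (Fin.cases ?_ (fun l => l.elim0))) j
    · rw [hcov0]; exact QhAbs.qha_cover_zero_mem (fun i => algebraMap (MvPolynomial (Fin 4) k) (Localization.Away hh) (X ((![0, 1, 2] : Fin 3 → Fin 4) i))) w _ _ hd₀
    · change cov 1 ∈ _; rw [hcov1]; exact QhAbs.qha_cover_one_mem (fun i => algebraMap (MvPolynomial (Fin 4) k) (Localization.Away hh) (X ((![0, 1, 2] : Fin 3 → Fin 4) i))) w sh hw0 (p := p) _ _ hd₁'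
    · change cov 2 ∈ _; rw [hcov2, hd₂, Nat.mul_comm]; exact pow_mem_weightedFiltration_ideal (fun i => algebraMap (MvPolynomial (Fin 4) k) (Localization.Away hh) (X ((![0, 1, 2] : Fin 3 → Fin 4) i))) w 2 n₂
  have hσy : ∀ j, (sigmaAway σ hσh) (y j : (Localization.Away hh)) = y j := fun j => by
    rw [hyval]
    refine Fin.cases ?_ (Fin.cases ?_ (Fin.cases ?_ (fun l => l.elim0))) j
    · rw [hcov0]; exact QhAbs.qha_cover_zero_fixed (sigmaAway σ hσh) (fun i => algebraMap (MvPolynomial (Fin 4) k) (Localization.Away hh) (X ((![0, 1, 2] : Fin 3 → Fin 4) i))) r0 _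
    · change (sigmaAway σ hσh) (cov 1) = cov 1; rw [hcov1]; exact QhAbs.qha_cover_one_fixed (sigmaAway σ hσh) (fun i => algebraMap (MvPolynomial (Fin 4) k) (Localization.Away hh) (X ((![0, 1, 2] : Fin 3 → Fin 4) i))) r0 r1 hp1 _
    · change (sigmaAway σ hσh) (cov 2) = cov 2; rw [hcov2, map_pow, r2]
  have hc0 := QhAbs.qha_coverElement_zero_eq (fun i => algebraMap (MvPolynomial (Fin 4) k) (Localization.Away hh) (X ((![0, 1, 2] : Fin 3 → Fin 4) i))) w mo 𝒜 (y 0) (hy 0) n₀ hd₀ (by rw [hyval, hcov0])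
  have hc1 := QhAbs.qha_coverElement_one_eq (fun i => algebraMap (MvPolynomial (Fin 4) k) (Localization.Away hh) (X ((![0, 1, 2] : Fin 3 → Fin 4) i))) w sh hw0 mo 𝒜 (y 1) (hy 1) n₁ hd₁' (by rw [hyval, hcov1])
  have hc2 := qha_coverElement_two_pow_eq (fun i => algebraMap (MvPolynomial (Fin 4) k) (Localization.Away hh) (X ((![0, 1, 2] : Fin 3 → Fin 4) i))) w mo 𝒜 (y 2) (hy 2) n₂ hd₂ (by rw [hyval, hcov2])
  have hrad : ∀ l : Fin 3, cobordantAlgebra.u' (fun i => algebraMap (MvPolynomial (Fin 4) k) (Localization.Away hh) (X ((![0, 1, 2] : Fin 3 → Fin 4) i))) w l ∈ (Ideal.span (Set.range fun j => coverElement 𝒜 (fun i => algebraMap (MvPolynomial (Fin 4) k) (Localization.Away hh) (X ((![0, 1, 2] : Fin 3 → Fin 4) i))) w dbar (y j) (hy j))).radical := fun l =>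
    QhAbs.qha_hrad (fun i => algebraMap (MvPolynomial (Fin 4) k) (Localization.Away hh) (X ((![0, 1, 2] : Fin 3 → Fin 4) i))) w sh (p := p) (fun j => coverElement 𝒜 (fun i => algebraMap (MvPolynomial (Fin 4) k) (Localization.Away hh) (X ((![0, 1, 2] : Fin 3 → Fin 4) i))) w dbar (y j) (hy j)) (n₂ := n₂) hn₁ hc0 hc1 (fun _ : Unit => cobordantAlgebra.u' (fun i => algebraMap (MvPolynomial (Fin 4) k) (Localization.Away hh) (X ((![0, 1, 2] : Fin 3 → Fin 4) i))) w 2)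
      (fun _ => by rw [sub_self]; exact Ideal.zero_mem _) (by rw [Finset.prod_const, Finset.card_univ, Fintype.card_unit, pow_one]; exact hc2) l
  have hmem0 := qhl_u'_zero_mem_residual σ h1 w sh hw0 hh hσh hp hσp hσJ
  refine ⟨y, hy, hσy, hcov0, hcov1, hcov2, hc0, hc1, hc2, hrad, fun j => ?_⟩
  exact QhAbs.qha_residualSection_zero (fun i => algebraMap (MvPolynomial (Fin 4) k) (Localization.Away hh) (X ((![0, 1, 2] : Fin 3 → Fin 4) i))) w mo 𝒜 (fun _ => h𝒜 _) (y j) (hy j) n₀ hd₀ _ hmem0 hn₀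

end Summit.ResolutionOfSingularities.ResolutionOfSingularities.Theorems.WildQuotientResolution.S1.KillCert.QhAway

end
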